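import Summits.Ventures.HodgeRepro.Night3GSetKunneth

/-!
# `kun` kills the OTHER Künneth components: the cross product of an `i`-wedge and a `j`-wedge with `(i, j) ≠ (n, k)` goes
to `0`

Blind re-derivation cell `pub-hodge-repro`, seat `night-3` (gen 4).  Imports night-3's `Night3GSetKunneth` (the
Künneth component projection `kun n k`, the lex-ordered wedge basis, `kun_of_coe_eq_mul`: `kun` inverts the exterior
cross product on the `(n, k)`-component).  Namespace `HodgeRepro.Night3.GSetModel`.

`Night3GSetKunneth` proves `kun ∘ (cross product) = id` on `⋀^n ℂ^{Fin n × G} ⊗ ⋀^k ℂ^{Fin k × G}` and that `kun` kills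
every basis vector `e_S` with `|S ∩ block₁| ≠ n` (`kun_wedgeBasis_of_ne`).  This file identifies those basis vectors
with the cross products of the OTHER degrees: for an `i`-set `T₁` in block 1 and a `j`-set `T₂` in block 2 with
`i + j = n + k`, the wedge `e_{inl T₁ ⊔ inr T₂}` of degree `n + k` is, in the exterior algebra, the product
`(map inlMap e_{T₁}) * (map inrMap e_{T₂})` of the degree-`i` and degree-`j` wedges (`coe_wedgeBasisD_blocksUnionPCD`,
sign `+1` by the same concatenation argument), and therefore **`kun_of_coe_eq_mul_of_ne`**: `kun n k x = 0` whenever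
`x ∈ ⋀^{n+k}` is such a product with `i ≠ n`.  Together with `kun_of_coe_eq_mul`: `kun n k` is EXACTLY the projection of
`⋀^{n+k}(V₁ ⊕ V₂) = ⊕_{i+j=n+k} ⋀^i V₁ ⊗ ⋀^j V₂` onto the `(n, k)`-summand (identity there, zero on the others) —
the Künneth component projection `H^{n+k}(B_M × B_N) → H^n(B_M) ⊗ H^k(B_N)` (Voisin I Thm 11.38).

Nothing here says anything about the status of the Hodge conjecture for CM abelian varieties, which is NOT proved.
-/

set_option autoImplicit false

open Finset Module
open scoped TensorProduct

namespace HodgeRepro.Night3.GSetModel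

open HodgeRepro.CMHodgeOn

section Degrees

variable {G : Type*} [Fintype G] [DecidableEq G] [LinearOrder G]

/-- The lex-ordered wedge basis of `⋀^d ℂ^{Fin n × G}` in an arbitrary degree `d`. -/
noncomputable def wedgeBasisD (n d : ℕ) : Basis (Set.powersetCard (Lex (Fin n × G)) d) ℂ (⋀[ℂ]^d (V G n)) :=
  (lexBasis n).exteriorPower d

/-- `wedgeBasisD n d S` is the wedge of the coordinate vectors of `S` in increasing lex order. -/
theorem wedgeBasisD_apply (n d : ℕ) (S : Set.powersetCard (Lex (Fin n × G)) d) :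
    wedgeBasisD n d S = exteriorPower.ιMulti ℂ d
      (fun i => coordVecOn (ofLex (Set.powersetCard.ofFinEmbEquiv.symm S i))) := by
  rw [wedgeBasisD, exteriorPower.basis_apply, exteriorPower.ιMulti_family]
  congr 1
  funext i
  exact lexBasis_apply n _

omit [DecidableEq G] in
/-- In degree `n` the general basis is `wedgeBasis`. -/
theorem wedgeBasisD_eq (n : ℕ) : wedgeBasisD (G := G) n n = wedgeBasis n := rfl

omit [DecidableEq G] in
/-- The same set in two (equal) degrees gives the same element of the exterior algebra. -/
theorem coe_wedgeBasisD_cast (n : ℕ) {d d' : ℕ} (h : d = d') (S : Set.powersetCard (Lex (Fin n × G)) d)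
    (S' : Set.powersetCard (Lex (Fin n × G)) d') (hS : (S : Finset (Lex (Fin n × G))) = S') :
    (wedgeBasisD n d S : ExteriorAlgebra ℂ (V G n)) = wedgeBasisD n d' S' := by
  subst h
  rw [Subtype.ext hS]

/-- The union of an `i`-set in block 1 and a `j`-set in block 2 is an `(i + j)`-set. -/
def blocksUnionPCD (n k i j : ℕ) (T₁ : Set.powersetCard (Lex (Fin n × G)) i)
    (T₂ : Set.powersetCard (Lex (Fin k × G)) j) : Set.powersetCard (Lex (Fin (n + k) × G)) (i + j) :=
  toPC (blocksUnion n k T₁ T₂) (by rw [card_blocksUnion, Set.powersetCard.card_eq, Set.powersetCard.card_eq])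

omit [Fintype G] in
/-- The increasing enumeration of `inl T₁ ⊔ inr T₂` is the concatenation of the increasing enumerations (any degrees). -/
theorem ofFinEmbEquiv_symm_blocksUnionPCD (n k i j : ℕ) (T₁ : Set.powersetCard (Lex (Fin n × G)) i)
    (T₂ : Set.powersetCard (Lex (Fin k × G)) j) :
    ⇑(Set.powersetCard.ofFinEmbEquiv.symm (blocksUnionPCD n k i j T₁ T₂)) =
      Fin.append (inlEmb n k ∘ Set.powersetCard.ofFinEmbEquiv.symm T₁)
        (inrEmb n k ∘ Set.powersetCard.ofFinEmbEquiv.symm T₂) := by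
  rw [Set.powersetCard.ofFinEmbEquiv_symm_apply]
  refine (Finset.orderEmbOfFin_unique (blocksUnionPCD n k i j T₁ T₂).prop (fun x => ?_) ?_).symm
  · refine Fin.addCases (fun a => ?_) (fun b => ?_) x
    · rw [Fin.append_left]
      exact (mem_blocksUnion n k _ _ _).mpr (Or.inl ⟨_, (Set.powersetCard.mem_range_ofFinEmbEquiv_symm_iff_mem T₁ _).mp
        ⟨a, rfl⟩, rfl⟩)
    · rw [Fin.append_right]
      exact (mem_blocksUnion n k _ _ _).mpr (Or.inr ⟨_, (Set.powersetCard.mem_range_ofFinEmbEquiv_symm_iff_mem T₂ _).mp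
        ⟨b, rfl⟩, rfl⟩)
  · intro x y hxy
    revert hxy
    refine Fin.addCases (fun a => ?_) (fun b => ?_) x <;> refine Fin.addCases (fun a' => ?_) (fun b' => ?_) y <;>
      intro hxy
    · rw [Fin.append_left, Fin.append_left]
      exact strictMono_inlEmb n k ((Set.powersetCard.ofFinEmbEquiv.symm T₁).strictMono
        ((Fin.strictMono_castAdd j).lt_iff_lt.mp hxy))
    · rw [Fin.append_left, Fin.append_right]
      exact inlEmb_lt_inrEmb n k _ _
    · exfalso
      have h1 : (Fin.natAdd i b).val < (Fin.castAdd j a').val := hxy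
      rw [Fin.val_natAdd, Fin.val_castAdd] at h1
      have := a'.isLt
      omega
    · rw [Fin.append_right, Fin.append_right]
      exact strictMono_inrEmb n k ((Set.powersetCard.ofFinEmbEquiv.symm T₂).strictMono
        ((Fin.strictMono_natAdd i).lt_iff_lt.mp hxy))

/-- **The exterior cross product in coordinates, any degrees**: `e_{inl T₁ ⊔ inr T₂} = (map inlMap e_{T₁}) * (map inrMap e_{T₂})`
in the exterior algebra, sign `+1`. -/
theorem coe_wedgeBasisD_blocksUnionPCD (n k i j : ℕ) (T₁ : Set.powersetCard (Lex (Fin n × G)) i)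
    (T₂ : Set.powersetCard (Lex (Fin k × G)) j) :
    (wedgeBasisD (n + k) (i + j) (blocksUnionPCD n k i j T₁ T₂) : ExteriorAlgebra ℂ (V G (n + k))) =
      ExteriorAlgebra.map (inlMap n k) (wedgeBasisD n i T₁) * ExteriorAlgebra.map (inrMap n k) (wedgeBasisD k j T₂) := by
  simp only [wedgeBasisD_apply, exteriorPower.ιMulti_apply_coe, ExteriorAlgebra.map_apply_ιMulti,
    ExteriorAlgebra.ιMulti_mul_ιMulti, ofFinEmbEquiv_symm_blocksUnionPCD]
  congr 1
  funext x
  refine Fin.addCases (fun a => ?_) (fun b => ?_) x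
  · rw [Fin.append_left, Fin.append_left]
    simp only [Function.comp_apply, inlMap_coordVecOn]
    rfl
  · rw [Fin.append_right, Fin.append_right]
    simp only [Function.comp_apply, inrMap_coordVecOn]
    rfl

omit [LinearOrder G] in
/-- Block 1 of `inl T₁ ⊔ inr T₂` has `|T₁|` elements. -/
theorem card_block₁_blocksUnionPCD (n k i j : ℕ) (T₁ : Set.powersetCard (Lex (Fin n × G)) i)
    (T₂ : Set.powersetCard (Lex (Fin k × G)) j) :
    (block₁ n k (blocksUnionPCD n k i j T₁ T₂ : Finset (Lex (Fin (n + k) × G)))).card = i := by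
  simp only [blocksUnionPCD, coe_toPC, block₁_blocksUnion, Set.powersetCard.card_eq]

/-- **`kun` kills the other Künneth components**: if `x ∈ ⋀^{n+k}` is, in the exterior algebra, the cross product of a
degree-`i` wedge of block 1 and a degree-`j` wedge of block 2 with `i ≠ n` (`i + j = n + k`), then `kun n k x = 0`. -/
theorem kun_of_coe_eq_mul_of_ne (n k i j : ℕ) (hij : i + j = n + k) (hi : i ≠ n)
    (T₁ : Set.powersetCard (Lex (Fin n × G)) i) (T₂ : Set.powersetCard (Lex (Fin k × G)) j) (x : Hn G (n + k))
    (hx : (x : ExteriorAlgebra ℂ (V G (n + k))) =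
      ExteriorAlgebra.map (inlMap n k) (wedgeBasisD n i T₁) * ExteriorAlgebra.map (inrMap n k) (wedgeBasisD k j T₂)) :
    kun n k x = 0 := by
  have hS : (blocksUnion n k (T₁ : Finset (Lex (Fin n × G))) (T₂ : Finset (Lex (Fin k × G)))).card = n + k := by
    rw [card_blocksUnion, Set.powersetCard.card_eq, Set.powersetCard.card_eq, hij]
  have hxe : x = wedgeBasis (n + k) (toPC _ hS) := by
    refine Subtype.ext (hx.trans ?_)
    rw [← coe_wedgeBasisD_blocksUnionPCD, ← wedgeBasisD_eq]
    exact coe_wedgeBasisD_cast (n + k) hij _ _ rfl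
  rw [hxe]
  refine kun_wedgeBasis_of_ne n k _ ?_
  rw [coe_toPC, block₁_blocksUnion, Set.powersetCard.card_eq]
  exact hi

end Degrees

end HodgeRepro.Night3.GSetModel
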